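import Literature.AlgebraicGeometry.HodgeTheory.CyclicReflectionSystemOfMeridians
import HarnessLib

/-!
# The Picard–Lefschetz package of a family of cyclic covers from meridian monodromies A POWER OF WHICH is the
# cyclic reflection (Carlson–Toledo 1999 §3, §7; linear algebra over `ℚ`)

Family `hodge`, layer `Literature/AlgebraicGeometry/HodgeTheory`; theorems only (no definition, no named fact);
a variant of `CyclicReflectionSystemOfMeridians` (prover-Bx g8).

`nonempty_cyclicReflectionSystem_of_meridians` assembles the hypothesis structure `CyclicReflectionSystem Γ B τ p`
(the Picard–Lefschetz package of a point of the universal family of `p`-cyclic covers of the plane: vanishing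
vectors, their cyclic reflections in `Γ` generating `Γ`, one orbit, spanning) from a set `𝓜 ⊆ Γ` of meridian
monodromies each of which IS the cyclic reflection `IsCyclicReflection B τ δ T` along its vanishing space. When the
local Picard–Lefschetz input is the `τ`-FREE monodromy of the `A_{p−1}`-degeneration (Milnor fibre of
`y^p = x₁² + x₂²`: `(T − 1)H ⊆ V`, `dim V = p − 1`, `T|_V` of order `p` without fixed vector), the recognition
theorem (`CyclicReflectionRecognition.exists_pow_isCyclicReflection_of_commute`) identifies only a POWER `r = T^k`
(`k` a unit mod `p`) with the cyclic reflection for the chosen covering automorphism `τ` — Carlson–Toledo's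
"`T = σ₀ ⊗ (−1) ⊗ (−1)`" for `σ₀` the local covering rotation, which is `σ^{±1}` or another generator of the
covering group according to conventions. This file proves that the package follows all the same
(`nonempty_cyclicReflectionSystem_of_meridian_powers`): per `T ∈ 𝓜` one asks for `r ∈ Γ` with `T ∈ ⟨r⟩`,
`IsCyclicReflection B τ δ r` with the §6 clauses for `δ`, and `range (T − 1) = ℚ[τ]δ` (the vanishing space is
read off `T` itself); the meridian monodromies `T ∈ 𝓜` are pairwise conjugate in `Γ` and generate `Γ`. Then the
reflections `r` lie in `Γ` and generate it (`T ∈ ⟨r⟩`), the vanishing spaces `range (T − 1)` form one orbit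
(`range (gTg⁻¹ − 1) = g · range (T − 1)`, `range_conj_sub_id_eq_map`), and they span the anti-invariant part
(`mem_iSup_cyclicSpan_of_invariants`).

Written by the prover seat `hodge-nonav-prover-Ax` (g9) for crux K1 of the route
`Summits/HodgeConjecture/HodgeConjecture/Theses/CyclicUnitaryPowers.lean` (re-cut of the cited meridian fact to the
`τ`-free local monodromy).

## References

* [CarlsonToledo1999] J. A. Carlson, D. Toledo, Discriminant complements and kernels of monodromy
  representations, Duke Math. J. 97 (1999); arXiv alg-geom/9708002, §3 (held text p0006–p0007), §6 Proposition
  (p0013–p0014), §7 last paragraph (p0015–p0016).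
-/

noncomputable section

namespace Literature.AlgebraicGeometry.HodgeTheory

section Algebra

variable {V : Type*} [AddCommGroup V] [Module ℚ V]

/-- **`range (gTg⁻¹ − 1) = g · range (T − 1)`**: vanishing spaces read off the monodromies move along conjugacies
("`γ' = κ⁻¹γκ` […] `δ' = ρ(κ⁻¹)(δ)`"; no hypothesis on `g`). [cite: CarlsonToledo1999, §3 (held text p0007)] -/
theorem range_conj_sub_id_eq_map (T g : V ≃ₗ[ℚ] V) :
    LinearMap.range (((g * T * g⁻¹ : V ≃ₗ[ℚ] V) : V →ₗ[ℚ] V) - LinearMap.id) =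
      (LinearMap.range ((T : V →ₗ[ℚ] V) - LinearMap.id)).map (g : V →ₗ[ℚ] V) := by
  have hcomp : (((g * T * g⁻¹ : V ≃ₗ[ℚ] V) : V →ₗ[ℚ] V) - LinearMap.id) =
      ((g : V →ₗ[ℚ] V).comp ((T : V →ₗ[ℚ] V) - LinearMap.id)).comp ((g⁻¹ : V ≃ₗ[ℚ] V) : V →ₗ[ℚ] V) := by
    ext x
    simp only [LinearMap.sub_apply, LinearMap.id_apply, LinearEquiv.coe_coe, LinearMap.comp_apply, map_sub]
    rw [LinearEquiv.mul_apply, LinearEquiv.mul_apply]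
    congr 1
    rw [LinearEquiv.coe_inv, LinearEquiv.apply_symm_apply]
  rw [hcomp, LinearMap.range_comp_of_range_eq_top _ (LinearEquiv.range _), LinearMap.range_comp]

/-- **The Picard–Lefschetz package from meridian monodromies a power of which is the cyclic reflection.** Data at a
base point: the monodromy group `Γ`; a set `𝓜 ⊆ Γ` (the monodromies of the meridians with a fixed one-nodal centre)
with `Γ ≤ closure 𝓜` (Zariski–van Kampen) and any two elements of `𝓜` conjugate in `Γ` (meridians of the
irreducible discriminant are conjugate); for each `T ∈ 𝓜` an element `r ∈ Γ` with `T ∈ ⟨r⟩` which is the cyclic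
reflection along `ℚ[τ]δ = range (T − 1)` for some `δ ≠ 0` with `Σ_{i<p} τ^i δ = 0`, `dim ℚ[τ]δ = p − 1`, `B`
non-degenerate on `ℚ[τ]δ` (the §6 Proposition for `r = T^k`, as delivered by
`exists_pow_isCyclicReflection_of_commute` from the `τ`-free local monodromy); and the `Γ`-invariants are
`τ`-invariant. Then, for `B` symmetric, non-degenerate, `τ`-invariant, `p ≠ 0` and `V` finite-dimensional,
`CyclicReflectionSystem Γ B τ p` holds with `R` the set of these `δ`.
[cite: CarlsonToledo1999, §3, §6 Proposition, §7 last paragraph (held text p0006–p0007, p0013–p0016)] -/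
theorem nonempty_cyclicReflectionSystem_of_meridian_powers [Module.Finite ℚ V] {B : LinearMap.BilinForm ℚ V}
    {τ : V ≃ₗ[ℚ] V} {p : ℕ} (hB : B.IsSymm) (hBnd : B.Nondegenerate)
    (hBτ : ∀ x y, B (τ x) (τ y) = B x y) (hp0 : p ≠ 0)
    {Γ : Subgroup (V ≃ₗ[ℚ] V)} {𝓜 : Set (V ≃ₗ[ℚ] V)}
    (hgen : Γ ≤ Subgroup.closure 𝓜)
    (hconj : ∀ T ∈ 𝓜, ∀ T' ∈ 𝓜, ∃ g ∈ Γ, T' = g * T * g⁻¹)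
    (hloc : ∀ T ∈ 𝓜, ∃ (r : V ≃ₗ[ℚ] V) (δ : V), r ∈ Γ ∧ T ∈ Subgroup.zpowers r ∧
      δ ≠ 0 ∧ (∑ i ∈ Finset.range p, (τ ^ i) δ) = 0 ∧
      Module.finrank ℚ (cyclicSpan τ δ) = p - 1 ∧
      (∀ x ∈ cyclicSpan τ δ, (∀ y ∈ cyclicSpan τ δ, B x y = 0) → x = 0) ∧ IsCyclicReflection B τ δ r ∧
      LinearMap.range ((T : V →ₗ[ℚ] V) - LinearMap.id) = cyclicSpan τ δ)
    (hinv : ∀ x : V, (∀ g ∈ Γ, g x = x) → τ x = x) :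
    Nonempty (CyclicReflectionSystem Γ B τ p) := by
  classical
  -- the reflection vectors attached to the meridian monodromies
  let R : Set V := {δ | ∃ T ∈ 𝓜, ∃ r : V ≃ₗ[ℚ] V, r ∈ Γ ∧ T ∈ Subgroup.zpowers r ∧
      δ ≠ 0 ∧ (∑ i ∈ Finset.range p, (τ ^ i) δ) = 0 ∧
      Module.finrank ℚ (cyclicSpan τ δ) = p - 1 ∧
      (∀ x ∈ cyclicSpan τ δ, (∀ y ∈ cyclicSpan τ δ, B x y = 0) → x = 0) ∧ IsCyclicReflection B τ δ r ∧
      LinearMap.range ((T : V →ₗ[ℚ] V) - LinearMap.id) = cyclicSpan τ δ}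
  -- `Γ ≤ closure 𝓜 ≤ closure {reflections}`: each `T ∈ 𝓜` is a power of its reflection `r`
  have hgen' : Γ ≤ Subgroup.closure {r | ∃ δ ∈ R, IsCyclicReflection B τ δ r} := by
    refine hgen.trans ((Subgroup.closure_le _).mpr fun T hT => ?_)
    obtain ⟨r, δ, hrΓ, hTr, h0, hΦ, hdim, hnd, hrefl, hrange⟩ := hloc T hT
    have hr : r ∈ Subgroup.closure {r | ∃ δ ∈ R, IsCyclicReflection B τ δ r} :=
      Subgroup.subset_closure ⟨δ, ⟨T, hT, r, hrΓ, hTr, h0, hΦ, hdim, hnd, hrefl, hrange⟩, hrefl⟩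
    exact (Subgroup.zpowers_le.mpr hr) hTr
  refine ⟨⟨R, ?_, ?_, ?_, ?_, ?_, hgen', ?_, ?_⟩⟩
  · rintro δ ⟨T, -, r, -, -, h0, -⟩
    exact h0
  · rintro δ ⟨T, -, r, -, -, -, hΦ, -⟩
    exact hΦ
  · rintro δ ⟨T, -, r, -, -, -, -, hdim, -⟩
    exact hdim
  · rintro δ ⟨T, -, r, -, -, -, -, -, hnd, -⟩
    exact hnd
  · rintro δ ⟨T, -, r, hrΓ, -, -, -, -, -, hrefl, -⟩
    exact ⟨r, hrΓ, hrefl⟩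
  · -- one orbit: `ℚ[τ]δ = range (T − 1)`, `ℚ[τ]δ' = range (T' − 1)`, `T = g T' g⁻¹`
    rintro δ ⟨T, hT, r, -, -, -, -, -, -, -, hrange⟩ δ' ⟨T', hT', r', -, -, -, -, -, -, -, hrange'⟩
    obtain ⟨g, hg, hgc⟩ := hconj T' hT' T hT
    refine ⟨g, hg, ?_⟩
    rw [← hrange', ← hrange, hgc, range_conj_sub_id_eq_map]
  · -- spanning
    intro x hx
    exact mem_iSup_cyclicSpan_of_invariants hB hBnd hBτ hp0 (Δ := Γ) (𝓡 := R) hgen' hinv x hx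

end Algebra

end Literature.AlgebraicGeometry.HodgeTheory

end
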